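import Literature.AlgebraicGeometry.FormalGeometry.WittGECokernelRestrict
import Literature.AlgebraicGeometry.Morphisms.FormalFunctionsModule
import Literature.AlgebraicGeometry.Morphisms.ProperPushforwardCoh
import HarnessLib

/-!
# The theorem on formal functions in degree `0` over an affine open of the TARGET of a proper map

Helper file toward the crux `PadicSemiregularLift.FormalVectorBundlesAlgebraize`
(stmt-HodgeConjecture-14106), proper case via a Chow cover.

Let `ρ : X' → X` be a proper morphism with `X` locally noetherian, `a ∈ Γ(X, 𝒪_X)` a global function,
`a' = ρ♯(a) ∈ Γ(X', 𝒪_{X'})`, `G` a coherent `𝒪_{X'}`-module and `V ⊆ X` an AFFINE open, `U = ρ⁻¹V`.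
The tree's theorem on formal functions for `H⁰` of a coherent module along a principal ideal
(`Morphisms/FormalFunctionsModule`: Görtz–Wedhorn II Thm. 24.37 for `p = 0`, `I = (a)`, as the two
halves with explicit shifts; Stacks 02OB/02OC) applies to the proper `Γ(V, 𝒪_X)`-scheme
`U → V = Spec Γ(V, 𝒪_X)` and the coherent restriction `G|_U`. This file transports its two halves
from the open SUBSCHEME `U` (sections of `G|_U` over `⊤`, quotients by `a|_V`) to the OPEN `U` of
`X'` (sections of `G` over `U`, quotients `G/a'ᵐG` of `G` itself), using the restriction
dictionary of `…AlgebraizeCokernelRestrict`: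

* `algebraMapΓ_restrict_pow_eq` — the structure map of `U → Spec Γ(V, 𝒪_X)` sends `(a|_V)ᵐ` to
  `a'ᵐ|_U`;
* `exists_ar_shift_over_affine` — **(AR) with shift**: there is `c` such that for all `n`, a
  section of `G` over `U` whose class in `Γ(U, G/a'ⁿ⁺ᶜG)` vanishes lies in `a'ⁿ Γ(U, G)`;
* `exists_ml_shift_over_affine` — **(ML) with shift**: there is `c` such that for all
  `n + c ≤ N`, every section of `G/a'ᴺG` over `U` reduces, in `Γ(U, G/a'ⁿG)`, to the class of a
  section of `G` over `U`.

Everything is proved; no definitions.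

Provenance: Literature home (family `hodge`, layer `Literature/AlgebraicGeometry/FormalGeometry`, namespace
`Literature.AlgebraicGeometry.FormalGeometry.WittGrothendieckExistence…`) of the Summits-side
`Theorems/PadicSemiregularLiftFormalVectorBundlesAlgebraizeRelativeFormalFunctions` (route `PadicSemiregularLift` / `AnchorTransport`,
Grothendieck existence for vector bundles over `W(k)`), which `Literature/` may not import; theorems only, no
named fact, no definition. Lane `lit-hodgefound`, seat p20.
-/

noncomputable section

-- `TopCat.Presheaf`/`Scheme.Modules` are not reducible (as in Mathlib's `AlgebraicGeometry/Modules`).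
set_option backward.isDefEq.respectTransparency false

open CategoryTheory CategoryTheory.Limits _root_.AlgebraicGeometry TopologicalSpace Opposite
open Literature.AlgebraicGeometry.Modules Literature.AlgebraicGeometry.Morphisms
open Literature.AlgebraicGeometry.Motives (Scheme.Modules.Hom.app_map_apply)

universe u

namespace Literature.AlgebraicGeometry.FormalGeometry.WittGrothendieckExistence.FormalVectorBundlesAlgebraize

variable {X' X : Scheme.{u}} (ρ : X' ⟶ X) (a : Γ(X, ⊤)) (G : X'.Modules) {V : X.Opens}
  (hV : IsAffineOpen V)

/-! ### The structure map of `ρ⁻¹V → Spec Γ(V, 𝒪_X)` and the global function `a` -/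

/-- `ρ♯` on the restriction of a global function: `ρ♯_V(a|_V) = ρ♯(a)|_{ρ⁻¹V}`. [cite: GortzWedhorn2023, proof of Thm. 24.94 and Prop. 24.95 (pp. 566–567), auxiliary step] -/
theorem app_restrict_eq_restrict_appTop (b : Γ(X, ⊤)) :
    ρ.app V (X.presheaf.map (homOfLE (le_top : V ≤ ⊤)).op b) =
      X'.presheaf.map (homOfLE (le_top : ρ ⁻¹ᵁ V ≤ ⊤)).op (ρ.appTop b) := by
  have h := ConcreteCategory.congr_hom (ρ.naturality (homOfLE (le_top : V ≤ ⊤)).op) b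
  simp only [CommRingCat.comp_apply] at h
  exact h.trans (congrArg (fun φ => X'.presheaf.map φ (ρ.appTop b)) (Subsingleton.elim _ _))

include hV in
/-- **The structure map `Γ(V, 𝒪_X) → Γ((ρ⁻¹V)(⊤), 𝒪)` of the `V`-scheme `ρ⁻¹V → V ≅ Spec Γ(V, 𝒪_X)`
sends `(a|_V)ᵐ` to the restriction `a'ᵐ|_{ρ⁻¹V}` of `a' = ρ♯(a)`** (as an element of
`Γ((ρ⁻¹V)(⊤), 𝒪) = Γ(X', (ρ⁻¹V).ι '' ⊤)`). [cite: GortzWedhorn2023, proof of Thm. 24.94 and Prop. 24.95 (pp. 566–567), auxiliary step] -/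
theorem algebraMapΓ_restrict_pow_eq (m : ℕ) :
    haveI : IsAffine V := hV
    algebraMapΓ ((ρ ∣_ V) ≫ hV.isoSpec.hom : (↑(ρ ⁻¹ᵁ V) : Scheme.{u}) ⟶ Spec (.of Γ(X, V)))
        (X.presheaf.map (homOfLE (le_top : V ≤ ⊤)).op a ^ m) =
      X'.presheaf.map (homOfLE (le_top : (ρ ⁻¹ᵁ V).ι ''ᵁ ⊤ ≤ ⊤)).op (ρ.appTop a ^ m) := by
  haveI : IsAffine V := hV
  set U : X'.Opens := ρ ⁻¹ᵁ V
  rw [map_pow, map_pow]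
  congr 1
  have h1 := topIso_hom_algebraMapΓ ρ hV (X.presheaf.map (homOfLE (le_top : V ≤ ⊤)).op a)
  rw [app_restrict_eq_restrict_appTop] at h1
  -- apply `U.topIso.inv` to both sides
  have h2 := congrArg U.topIso.inv h1
  rw [Iso.hom_inv_id_apply] at h2
  rw [h2, Scheme.Opens.topIso_inv]
  change (X'.presheaf.map _ ≫ X'.presheaf.map _) (ρ.appTop a) = _
  rw [← Functor.map_comp]
  exact congrArg (fun φ => X'.presheaf.map φ (ρ.appTop a)) (Subsingleton.elim _ _)

/-! ### The two halves of the theorem on formal functions, over the open `ρ⁻¹V` -/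

section FormalFunctions

variable [IsProper ρ] [IsLocallyNoetherian X] {G}

include hV in
/-- **(AR) injectivity half with shift, over an affine open of the target.** For `ρ : X' → X`
proper, `X` locally noetherian, `G` coherent on `X'` and `V ⊆ X` affine open, there is `c` such that
for all `n`, every section `h ∈ Γ(ρ⁻¹V, G)` whose class in `Γ(ρ⁻¹V, G/a'ⁿ⁺ᶜG)` vanishes is
`a'ⁿ u` for some `u ∈ Γ(ρ⁻¹V, G)` (GW II Thm. 24.37, `p = 0`, `I = (a)`, Artin–Rees half, applied
to `ρ⁻¹V → Spec Γ(V, 𝒪_X)` and `G|_{ρ⁻¹V}`). [cite: GortzWedhorn2023, proof of Thm. 24.94 and Prop. 24.95 (pp. 566–567), auxiliary step] -/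
theorem exists_ar_shift_over_affine (hG : Coh G) :
    ∃ c : ℕ, ∀ (n : ℕ) (h : Γ(G, ρ ⁻¹ᵁ V)),
      (cokernel.π (globalScalar G (ρ.appTop a ^ (n + c)))).app (ρ ⁻¹ᵁ V) h = 0 →
        ∃ u : Γ(G, ρ ⁻¹ᵁ V), h = (globalScalar G (ρ.appTop a ^ n)).app (ρ ⁻¹ᵁ V) u := by
  haveI : IsAffine V := hV
  haveI : IsNoetherianRing Γ(X, V) := IsLocallyNoetherian.component_noetherian ⟨V, hV⟩
  haveI : IsLocallyNoetherian X' := LocallyOfFiniteType.isLocallyNoetherian ρ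
  set U : X'.Opens := ρ ⁻¹ᵁ V with hU
  let f' : (↑U : Scheme.{u}) ⟶ Spec (.of Γ(X, V)) := (ρ ∣_ V) ≫ hV.isoSpec.hom
  haveI : IsProper (ρ ∣_ V) := MorphismProperty.of_isPullback (isPullback_morphismRestrict ρ V).flip ‹_›
  haveI : IsProper f' := inferInstance
  set aV : Γ(X, V) := X.presheaf.map (homOfLE (le_top : V ≤ ⊤)).op a with haV
  let R := Scheme.Modules.restrictFunctor U.ι
  obtain ⟨c, hc⟩ := exists_eq_pow_smul_of_app_cokernel_π_eq_zero f' aV (coh_restrict U.ι G hG)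
  refine ⟨c, fun n h hh => ?_⟩
  -- the quotients of `G|_U` by `(a|_V)ᵐ` are the restrictions of the quotients `G/a'ᵐG`
  have hq : ∀ m : ℕ, algebraMapΓ f' (aV ^ m) =
      X'.presheaf.map (homOfLE (le_top : U.ι ''ᵁ ⊤ ≤ ⊤)).op (ρ.appTop a ^ m) :=
    fun m => algebraMapΓ_restrict_pow_eq ρ a hV m
  obtain ⟨e, he⟩ := exists_restrict_cokernelIso U G (ρ.appTop a ^ (n + c)) _ (hq (n + c))
  -- move `h` to the open subscheme
  let h₁ : MSections f' (R.obj G) ⊤ := G.presheaf.map (homOfLE U.ι_image_top.le).op h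
  have hh₁ : MSections.app f' (cokernel.π (globalScalar (R.obj G) (algebraMapΓ f' (aV ^ (n + c))))) ⊤
      h₁ = 0 := by
    change (cokernel.π (globalScalar (R.obj G) (algebraMapΓ f' (aV ^ (n + c))))).app ⊤ h₁ = 0
    rw [← he]
    change e.hom.app ⊤ ((R.map (cokernel.π (globalScalar G (ρ.appTop a ^ (n + c))))).app ⊤ h₁) = 0
    rw [restrictFunctor_map_app']
    change e.hom.app ⊤ ((cokernel.π (globalScalar G (ρ.appTop a ^ (n + c)))).app (U.ι ''ᵁ ⊤)
      (G.presheaf.map (homOfLE U.ι_image_top.le).op h)) = 0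
    rw [Scheme.Modules.Hom.app_map_apply, hh, map_zero, map_zero]
  obtain ⟨u₁, hu₁⟩ := hc n h₁ hh₁
  refine ⟨G.presheaf.map (homOfLE U.ι_image_top.ge).op (show Γ(G, U.ι ''ᵁ ⊤) from u₁), ?_⟩
  -- `h = (h₁)|_U = (aVⁿ • u₁)|_U = a'ⁿ • u₁|_U`
  have key : (show Γ(G, U.ι ''ᵁ ⊤) from h₁) =
      (globalScalar G (ρ.appTop a ^ n)).app (U.ι ''ᵁ ⊤) (show Γ(G, U.ι ''ᵁ ⊤) from u₁) := by
    have e1 : (show Γ(G, U.ι ''ᵁ ⊤) from h₁) =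
        MSections.app f' (globalScalar (R.obj G) (algebraMapΓ f' (aV ^ n))) ⊤ u₁ := by
      rw [app_globalScalar_algebraMapΓ]; exact hu₁
    rw [e1]
    change ((globalScalar (R.obj G) (algebraMapΓ f' (aV ^ n)))).app ⊤ u₁ = _
    rw [← restrictFunctor_map_globalScalar U G (ρ.appTop a ^ n) _ (hq n), restrictFunctor_map_app']
  calc h = G.presheaf.map (homOfLE U.ι_image_top.ge).op (show Γ(G, U.ι ''ᵁ ⊤) from h₁) :=
        (map_map_ι_image_top U G h).symm
    _ = _ := by rw [key, ← Scheme.Modules.Hom.app_map_apply]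

include hV in
/-- **(ML) surjectivity half with shift, over an affine open of the target.** For `ρ : X' → X`
proper, `X` locally noetherian, `G` coherent on `X'` and `V ⊆ X` affine open, there is `c` such that
for all `n + c ≤ N` and every reduction map `r : G/a'ᴺG → G/a'ⁿG` under `G`, every section `t` of
`G/a'ᴺG` over `ρ⁻¹V` has `r(t)` equal to the class of a section of `G` over `ρ⁻¹V` (GW II
Lemma 24.40 / Thm. 24.37, `p = 0`, `I = (a)`, Mittag-Leffler half, applied to
`ρ⁻¹V → Spec Γ(V, 𝒪_X)` and `G|_{ρ⁻¹V}`, transported by `lift_sections_of_lift_restrict`). [cite: GortzWedhorn2023, proof of Thm. 24.94 and Prop. 24.95 (pp. 566–567), auxiliary step] -/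
theorem exists_ml_shift_over_affine (hG : Coh G) :
    ∃ c : ℕ, ∀ (n N : ℕ), n + c ≤ N →
      ∀ (r : cokernel (globalScalar G (ρ.appTop a ^ N)) ⟶ cokernel (globalScalar G (ρ.appTop a ^ n))),
        cokernel.π (globalScalar G (ρ.appTop a ^ N)) ≫ r =
          cokernel.π (globalScalar G (ρ.appTop a ^ n)) →
        ∀ t : Γ(cokernel (globalScalar G (ρ.appTop a ^ N)), ρ ⁻¹ᵁ V),
          ∃ s : Γ(G, ρ ⁻¹ᵁ V),
            (cokernel.π (globalScalar G (ρ.appTop a ^ n))).app (ρ ⁻¹ᵁ V) s = r.app (ρ ⁻¹ᵁ V) t := by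
  haveI : IsAffine V := hV
  haveI : IsNoetherianRing Γ(X, V) := IsLocallyNoetherian.component_noetherian ⟨V, hV⟩
  haveI : IsLocallyNoetherian X' := LocallyOfFiniteType.isLocallyNoetherian ρ
  set U : X'.Opens := ρ ⁻¹ᵁ V with hU
  let f' : (↑U : Scheme.{u}) ⟶ Spec (.of Γ(X, V)) := (ρ ∣_ V) ≫ hV.isoSpec.hom
  haveI : IsProper (ρ ∣_ V) := MorphismProperty.of_isPullback (isPullback_morphismRestrict ρ V).flip ‹_›
  haveI : IsProper f' := inferInstance
  set aV : Γ(X, V) := X.presheaf.map (homOfLE (le_top : V ≤ ⊤)).op a with haV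
  let R := Scheme.Modules.restrictFunctor U.ι
  obtain ⟨c, hc⟩ := exists_app_cokernel_π_eq_of_le f' aV (coh_restrict U.ι G hG)
  refine ⟨c, fun n N hnN r hr t => ?_⟩
  have hq : ∀ m : ℕ, algebraMapΓ f' (aV ^ m) =
      X'.presheaf.map (homOfLE (le_top : U.ι ''ᵁ ⊤ ≤ ⊤)).op (ρ.appTop a ^ m) :=
    fun m => algebraMapΓ_restrict_pow_eq ρ a hV m
  obtain ⟨eN, heN⟩ := exists_restrict_cokernelIso U G (ρ.appTop a ^ N) _ (hq N)
  obtain ⟨en, hen⟩ := exists_restrict_cokernelIso U G (ρ.appTop a ^ n) _ (hq n)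
  -- the reduction map on the open subscheme
  obtain ⟨d, hd⟩ : ∃ d : ℕ, N = d + n := ⟨N - n, by omega⟩
  obtain ⟨r', hr'⟩ := exists_reduction (R.obj G) (q := algebraMapΓ f' (aV ^ n))
    (q' := algebraMapΓ f' (aV ^ N)) (d := algebraMapΓ f' (aV ^ d)) (by rw [← map_mul, ← pow_add, ← hd])
  refine lift_sections_of_lift_restrict U G eN heN en hen r hr r' hr' (fun t' => ?_) t
  obtain ⟨s', hs'⟩ := hc n N hnN r' hr' t'
  exact ⟨s', hs'⟩

end FormalFunctions

end Literature.AlgebraicGeometry.FormalGeometry.WittGrothendieckExistence.FormalVectorBundlesAlgebraize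

end
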